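import Summits.CriticalPhenomena.PercolationContinuityZ3.Theorems.Transplant.KNCells2ThetaPos
import Summits.CriticalPhenomena.PercolationContinuityZ3.Theorems.Transplant.KNCells2WitnessLevel
import HarnessLib

/-!
# F8 (generic, lag-1 anchors) under design (D): the KIT form of the node theorem WITHOUT degree/envelope bounds —
# `theta_pos_of_kit₂` / `theta_pos_of_kit₂'` (= `fail_bound₂` ∘ `theta_pos_of_cells₂`; the (D)-endgame twins of `samePWitnessAt_of_kit₂` /
# `samePWitnessAt_of_kit₂'`) (HOME/ENTRY-SEED-STAR.md §10; lead V56 G2/G3 and 13:34:23Z: "land `theta_pos_of_kit₂` := fail_bound₂'s hypotheses …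
# WITHOUT hB ⇒ 0 < θ, a 10-line composition mirroring samePWitnessAt_of_kit₂'")

builds on p205010 (kernel theorem, internal audit signed; external expert review pending) — nothing in this file uses p205010.
Lane `prim-bschramm`, seat `prim-bschramm-stmt` (gen 4; claimed in the lane INBOX 13:57Z after p2-g2's silence on V56); helper file
(`--supports stmt-CriticalPhenomena-4575`).  Used by the (D) assembly skeleton `BoxProdZ2ConcAssembly` (stmt) and by the instance (p3-g2 / p2-g2 G4).

* **`theta_pos_of_kit₂`** — `RunGeom`, `AnchGeom`, `SepGeom₂`, `ExitGeom`, `StepsGeom`, `δc ≤ 1`, `ε ≤ 2⁻³²`, `0 ≤ ε'`, `δ₂ ≤ 1`,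
  `4((1-δ₂)^K + ε') ≤ ε`, `0 < p`, (32) at the root (`hQ0`), and per valid history at the history anchors: the face-prefix inputs `hP1`/`hP2`,
  the target lemma at the faces (`hface`) and the corridor bound (`hreach`) ⟹ `0 < θ_{root}(p)`.  No degree bound `hΔ`, no envelope bound
  `hB` (those served only Theorem A's perturbation, replaced in (D) by re-running the construction at a smaller density).
* **`theta_pos_of_kit₂'`** — the same with `hP1`/`hP2` discharged by a level geometry (`facePrefix₂_P1/P2`); `criticalProb_le_of_kit₂'`.
[cite: KozmaNitzan2024, §4 Theorem 6 (pp. 25–31), §1 p. 2 (approach 1)]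
-/

noncomputable section

open MeasureTheory ProbabilityTheory
open scoped ENNReal Classical

namespace Summit.CriticalPhenomena.PercolationContinuityZ3.Theorems

namespace Transplant

namespace KNCells

open Literature.Probability.Percolation Literature.Probability.LatticeModels SimpleGraph GadgetSystem ProbeHistory HSiteScheme Contour

variable {V : Type} [DecidableEq V] [Countable V]

namespace KSchA

variable {A : Type*} {G : SimpleGraph V} [G.LocallyFinite] {S : KSchA V A} {FD : FaceData V A} {LD : LevelData V A}

/-- **THE NODE OVER ANCHORED CELLS, KIT FORM, NO ENVELOPE BOUND**: the hypotheses of `fail_bound₂` after every valid history plus the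
geometry and root inputs give `θ_{root}(p) > 0`. [cite: KozmaNitzan2024, §4 Theorem 6 (pp. 25–31)] -/
theorem theta_pos_of_kit₂ (hΓ : RunGeom G S.Γ) (hA : AnchGeom S.Γ) (hsep : SepGeom₂ G S.Γ) (hX : ExitGeom G S.Γ)
    (hSt : StepsGeom S.Γ FD) (hδc : S.δc ≤ 1) {ε ε' δ₂ : ℝ} (hε : ε ≤ (1 / 2) ^ 32) (hε' : 0 ≤ ε') (hδ₂ : δ₂ ≤ 1)
    (hKε : 4 * ((1 - δ₂) ^ S.Γ.K + ε') ≤ ε) (hp : 0 < (S.p : ℝ))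
    (hQ0 : ∀ du : MDir, 1 - S.δc < (prodBernoulli (pinW (KNLevels.lattW G S.p) ↑(S.U₀ G) ↑(S.U₀ G))).real
      (⋃ t ∈ (↑(S.Γ.M S.Γ.a₀ ((0 : Site 2) + stepVec du)) : Set V),
        openConnIn (↑(S.Γ.Q S.Γ.a₀ 0 ∪ S.Γ.Ewv S.Γ.a₀ 0 du) : Set V) S.Γ.root t))
    (hP1 : ∀ h e, S.Valid₂ G h e → ∀ du ∈ S.onward G h (tgt e), ∀ ω,
      ω ∈ KNLevels.lattOnly G (S.Vx G h ∪ S.Γ.Ewv (S.aOf₁ G h e) e.1 e.2 ∪ FD.Hfull (S.aOf₂ G h e) (tgt e) du) →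
      ω ∈ S.Reach G FD h e (S.aOf₁ G h e) (S.aOf₂ G h e) du → ω ∈ S.Aface G FD h e (S.aOf₁ G h e) (S.aOf₂ G h e) du (S.Γ.K - 1))
    (hP2 : ∀ h e, S.Valid₂ G h e → ∀ du ∈ S.onward G h (tgt e), ∀ ω j, 1 ≤ j → j < S.Γ.K →
      ω ∈ KNLevels.lattOnly G (S.Vx G h ∪ S.Γ.Ewv (S.aOf₁ G h e) e.1 e.2 ∪ S.Γ.Stub (S.aOf₂ G h e) (tgt e) du (j + 1)) →
      ω ∈ S.Aface G FD h e (S.aOf₁ G h e) (S.aOf₂ G h e) du j → ω ∈ S.Aface G FD h e (S.aOf₁ G h e) (S.aOf₂ G h e) du (j - 1))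
    (hface : ∀ h e, S.Valid₂ G h e → ∀ du ∈ S.onward G h (tgt e), ∀ j < S.Γ.K, ∀ o : Finset (Sym2 V),
      1 - δ₂ < (prodBernoulli (S.Wt G h e (S.aOf₁ G h e) (S.aOf₂ G h e) du j o)).real
        (⋃ b ∈ FD.Face (S.aOf₂ G h e) (tgt e) du (j + 1), openConn S.Γ.root b) →
        S.cond G h e (S.aOf₁ G h e) (S.aOf₂ G h e) du j o)
    (hreach : ∀ h e, S.Valid₂ G h e → ∀ du ∈ S.onward G h (tgt e),
      1 - ε' < (prodBernoulli (S.Wfull G h e (S.aOf₁ G h e) (S.aOf₂ G h e) du)).real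
        (S.Reach G FD h e (S.aOf₁ G h e) (S.aOf₂ G h e) du)) :
    0 < theta G S.Γ.root S.p := by
  refine theta_pos_of_cells₂ hΓ hA hsep hX hδc hε hp hQ0 fun h e hV => ?_
  exact (fail_bound₂ hV.anch hV hSt hε' hδ₂ (hP1 h e hV) (hP2 h e hV) (hface h e hV) (hreach h e hV)).trans hKε

/-- **THE NODE OVER ANCHORED CELLS, KIT FORM with a level geometry, NO ENVELOPE BOUND**: as `theta_pos_of_kit₂` with the face-prefix inputs
discharged by `LevelGeom`. [cite: KozmaNitzan2024, §4 Theorem 6 (pp. 25–31)] -/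
theorem theta_pos_of_kit₂' (hΓ : RunGeom G S.Γ) (hA : AnchGeom S.Γ) (hsep : SepGeom₂ G S.Γ) (hX : ExitGeom G S.Γ)
    (hSt : StepsGeom S.Γ FD) (hL : LevelGeom G S.Γ FD LD) (hδc : S.δc ≤ 1) {ε ε' δ₂ : ℝ} (hε : ε ≤ (1 / 2) ^ 32) (hε' : 0 ≤ ε')
    (hδ₂ : δ₂ ≤ 1) (hKε : 4 * ((1 - δ₂) ^ S.Γ.K + ε') ≤ ε) (hp : 0 < (S.p : ℝ))
    (hQ0 : ∀ du : MDir, 1 - S.δc < (prodBernoulli (pinW (KNLevels.lattW G S.p) ↑(S.U₀ G) ↑(S.U₀ G))).real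
      (⋃ t ∈ (↑(S.Γ.M S.Γ.a₀ ((0 : Site 2) + stepVec du)) : Set V),
        openConnIn (↑(S.Γ.Q S.Γ.a₀ 0 ∪ S.Γ.Ewv S.Γ.a₀ 0 du) : Set V) S.Γ.root t))
    (hface : ∀ h e, S.Valid₂ G h e → ∀ du ∈ S.onward G h (tgt e), ∀ j < S.Γ.K, ∀ o : Finset (Sym2 V),
      1 - δ₂ < (prodBernoulli (S.Wt G h e (S.aOf₁ G h e) (S.aOf₂ G h e) du j o)).real
        (⋃ b ∈ FD.Face (S.aOf₂ G h e) (tgt e) du (j + 1), openConn S.Γ.root b) →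
        S.cond G h e (S.aOf₁ G h e) (S.aOf₂ G h e) du j o)
    (hreach : ∀ h e, S.Valid₂ G h e → ∀ du ∈ S.onward G h (tgt e),
      1 - ε' < (prodBernoulli (S.Wfull G h e (S.aOf₁ G h e) (S.aOf₂ G h e) du)).real
        (S.Reach G FD h e (S.aOf₁ G h e) (S.aOf₂ G h e) du)) :
    0 < theta G S.Γ.root S.p :=
  theta_pos_of_kit₂ hΓ hA hsep hX hSt hδc hε hε' hδ₂ hKε hp hQ0 (fun _ _ hV => facePrefix₂_P1 hL hV)
    (fun _ _ hV => facePrefix₂_P2 hL hSt hV) hface hreach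

/-- Hence `p_c(G, root) ≤ p` for such a kit at `p`. [cite: KozmaNitzan2024, §1 p. 2 (approach 1)] -/
theorem criticalProb_le_of_kit₂' (hΓ : RunGeom G S.Γ) (hA : AnchGeom S.Γ) (hsep : SepGeom₂ G S.Γ) (hX : ExitGeom G S.Γ)
    (hSt : StepsGeom S.Γ FD) (hL : LevelGeom G S.Γ FD LD) (hδc : S.δc ≤ 1) {ε ε' δ₂ : ℝ} (hε : ε ≤ (1 / 2) ^ 32) (hε' : 0 ≤ ε')
    (hδ₂ : δ₂ ≤ 1) (hKε : 4 * ((1 - δ₂) ^ S.Γ.K + ε') ≤ ε) (hp : 0 < (S.p : ℝ))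
    (hQ0 : ∀ du : MDir, 1 - S.δc < (prodBernoulli (pinW (KNLevels.lattW G S.p) ↑(S.U₀ G) ↑(S.U₀ G))).real
      (⋃ t ∈ (↑(S.Γ.M S.Γ.a₀ ((0 : Site 2) + stepVec du)) : Set V),
        openConnIn (↑(S.Γ.Q S.Γ.a₀ 0 ∪ S.Γ.Ewv S.Γ.a₀ 0 du) : Set V) S.Γ.root t))
    (hface : ∀ h e, S.Valid₂ G h e → ∀ du ∈ S.onward G h (tgt e), ∀ j < S.Γ.K, ∀ o : Finset (Sym2 V),
      1 - δ₂ < (prodBernoulli (S.Wt G h e (S.aOf₁ G h e) (S.aOf₂ G h e) du j o)).real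
        (⋃ b ∈ FD.Face (S.aOf₂ G h e) (tgt e) du (j + 1), openConn S.Γ.root b) →
        S.cond G h e (S.aOf₁ G h e) (S.aOf₂ G h e) du j o)
    (hreach : ∀ h e, S.Valid₂ G h e → ∀ du ∈ S.onward G h (tgt e),
      1 - ε' < (prodBernoulli (S.Wfull G h e (S.aOf₁ G h e) (S.aOf₂ G h e) du)).real
        (S.Reach G FD h e (S.aOf₁ G h e) (S.aOf₂ G h e) du)) :
    criticalProb G S.Γ.root ≤ S.p :=
  OrbitQuotient.criticalProb_le_of_theta_pos G S.Γ.root S.p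
    (theta_pos_of_kit₂' hΓ hA hsep hX hSt hL hδc hε hε' hδ₂ hKε hp hQ0 hface hreach)

end KSchA

end KNCells

end Transplant

end Summit.CriticalPhenomena.PercolationContinuityZ3.Theorems

end
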